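import Summits.Ventures.PercRepro.RankDistUpSetGirth

/-!
# PercRepro — SERIES CLASSES AND THE BOTTOM SETS OF THE TIGHT LAYER: rank additivity along a series class, and in a
cell with a series class of the maximal size `p − q + 2` every bottom set is `B₀ ∪ {s}` with `s ∈ S` free
(p9, gen 22)

Tight layer: `|E| = p + q`, `ρ(E) = p`, bottom sets `𝓑 = PerFlat.Uq M p q` (the independent `q`-sets whose complement
is a base). A SERIES CLASS is a finset `S` of elements, none a coloop, every two of which form a cocircuit (`{x, y}`
is a cocircuit: in a graph, two edges every cycle uses together — a path through vertices of degree two).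
* `notMem_closure_of_isCocircuit_pair`: a set avoiding a cocircuit `{x, y}` spans neither element;
* `rk_union_eq_of_series`: `A₀` avoiding `S`, `T ⊆ S ∖ x`: `ρ(A₀ ∪ T) = ρ(A₀) + |T|`;
* `rk_union_self_eq_of_series`: if moreover `A₀` spans `E ∖ S`, `ρ(A₀ ∪ S) + 1 = ρ(A₀) + |S|`;
* `rk_ground_sdiff_add_card_of_series`: `ρ(E ∖ S) + |S| = ρ(E) + 1`.
On the tight layer with `|S| + q = p + 2` (the MAXIMAL size a series class can have when a bottom set exists: a
bottom set meets `S` in at most one element, its complement — a base — misses at most one), `ρ(E ∖ S) = q − 1`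
(`rk_ground_sdiff_of_series_degenerate`), every bottom set meets `S` in EXACTLY one element, its `S`-free part and
the `S`-free part of its complement both have rank `q − 1` (`mem_Uq_series_degenerate`), and the `S`-element of a
bottom set can be replaced by ANY element of `S` (`sdiff_union_singleton_mem_Uq_of_series`): `𝓑 = 𝓑₀ × S`. These
are the SERIES-DEGENERATE CELLS; `RankDistSeriesDegenerate` computes their whole shadow profile. Nothing here moves
any window of the crux.
-/

namespace PercRepro.RankDist

open Set Finset _root_.Matroid PercRepro.ThmH

variable {α : Type} (M : Matroid α) [M.Finite]

/-! ## Series pairs -/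

omit [M.Finite] in
/-- `{x, y}` a cocircuit, `x ≠ y`: a set avoiding both does not span `y` (its closure lies in the hyperplane
`E ∖ {x, y}`). -/
lemma notMem_closure_of_isCocircuit_pair {x y : α} (hK : M.IsCocircuit {x, y}) (hxy : x ≠ y) {X : Set α}
    (hX : X ⊆ M.E \ {x, y}) : y ∉ M.closure X := by
  intro hy
  have hyE : y ∈ M.E := M.closure_subset_ground X hy
  rw [isCocircuit_iff_minimal_compl_nonspanning] at hK
  have hsp : M.Spanning (M.E \ {x}) := by
    by_contra hns
    have h := hK.2 hns (Set.singleton_subset_iff.2 (by simp))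
    have hyx : y ∈ ({x} : Set α) := h (by simp)
    exact hxy (Set.mem_singleton_iff.1 hyx).symm
  apply hK.1
  have h1 : y ∈ M.closure (M.E \ {x, y}) := M.closure_subset_closure hX hy
  have h2 := M.closure_insert_eq_of_mem_closure h1
  have h3 : insert y (M.E \ {x, y}) = M.E \ {x} := by
    ext z
    simp only [Set.mem_insert_iff, Set.mem_sdiff, Set.mem_singleton_iff]
    constructor
    · rintro (rfl | ⟨hz, hz2⟩)
      · exact ⟨hyE, hxy.symm⟩
      · exact ⟨hz, fun h => hz2 (Or.inl h)⟩
    · rintro ⟨hz, hzx⟩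
      by_cases hzy : z = y
      · exact Or.inl hzy
      · exact Or.inr ⟨hz, fun h => h.elim hzx hzy⟩
  rw [spanning_iff_closure_eq Set.sdiff_subset, ← h2, h3]
  exact hsp.closure_eq

variable [DecidableEq α]

/-- **Rank additivity along a series class**: `S` pairwise in series (every two elements a cocircuit), `A₀` a set
avoiding `S`, `x ∈ S`, `T ⊆ S ∖ x`: `ρ(A₀ ∪ T) = ρ(A₀) + |T|`. -/
lemma rk_union_eq_of_series {S : Finset α} (hSE : (S : Set α) ⊆ M.E)
    (hser : ∀ x ∈ S, ∀ y ∈ S, x ≠ y → M.IsCocircuit {x, y})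
    {A₀ : Set α} (hA₀ : A₀ ⊆ M.E \ (S : Set α)) {x : α} (hx : x ∈ S) {T : Finset α} (hT : T ⊆ S.erase x) :
    rk M (A₀ ∪ (T : Set α)) = rk M A₀ + T.card := by
  induction T using Finset.induction_on with
  | empty => simp
  | insert y T' hyT' ih =>
    have hT' : T' ⊆ S.erase x := (Finset.subset_insert y T').trans hT
    have hy : y ∈ S.erase x := hT (Finset.mem_insert_self y T')
    have hyS : y ∈ S := Finset.mem_of_mem_erase hy
    have hyx : y ≠ x := Finset.ne_of_mem_erase hy
    have hK := hser x hx y hyS hyx.symm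
    have hsub : A₀ ∪ (T' : Set α) ⊆ M.E \ {x, y} := by
      intro z hz
      rcases hz with hz | hz
      · have hz' := hA₀ hz
        refine ⟨hz'.1, fun h => hz'.2 ?_⟩
        rcases h with rfl | rfl
        · exact hx
        · exact hyS
      · have hzT' : z ∈ T' := Finset.mem_coe.1 hz
        have hzS : z ∈ S.erase x := hT' hzT'
        refine ⟨hSE (Finset.mem_coe.2 (Finset.mem_of_mem_erase hzS)), fun h => ?_⟩
        rcases h with rfl | rfl
        · exact Finset.ne_of_mem_erase hzS rfl
        · exact hyT' hzT'
    have hE : A₀ ∪ (T' : Set α) ⊆ M.E := hsub.trans Set.sdiff_subset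
    rw [Finset.coe_insert, Set.union_insert,
      rk_insert_of_notMem_closure_set M (hSE (Finset.mem_coe.2 hyS)) hE
        (notMem_closure_of_isCocircuit_pair M hK hyx.symm hsub),
      ih hT', Finset.card_insert_of_notMem hyT']
    omega

/-- **The whole class adds `|S| − 1`**: `S` pairwise in series without coloops, `A₀` avoiding `S` and spanning
`E ∖ S` (`E ∖ S ⊆ cl(A₀)`): `ρ(A₀ ∪ S) + 1 = ρ(A₀) + |S|` (the last element of `S` is spanned by the rest). -/
lemma rk_union_self_eq_of_series {S : Finset α} (hSE : (S : Set α) ⊆ M.E)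
    (hser : ∀ x ∈ S, ∀ y ∈ S, x ≠ y → M.IsCocircuit {x, y}) (hnc : ∀ x ∈ S, ¬ M.IsColoop x)
    {A₀ : Set α} (hA₀ : A₀ ⊆ M.E \ (S : Set α)) (hspan : M.E \ (S : Set α) ⊆ M.closure A₀) {s : α}
    (hs : s ∈ S) : rk M (A₀ ∪ (S : Set α)) + 1 = rk M A₀ + S.card := by
  have hE' : A₀ ∪ ((S.erase s : Finset α) : Set α) ⊆ M.E := by
    refine Set.union_subset (hA₀.trans Set.sdiff_subset) ?_
    intro z hz
    exact hSE (Finset.mem_coe.2 (Finset.mem_of_mem_erase (Finset.mem_coe.1 hz)))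
  have hcl : s ∈ M.closure (A₀ ∪ ((S.erase s : Finset α) : Set α)) := by
    have h1 : s ∈ M.closure (M.E \ {s}) := by
      have h := hnc s hs
      rwa [isColoop_iff_notMem_closure_compl (hSE (Finset.mem_coe.2 hs)), not_not] at h
    have h2 : M.E \ {s} ⊆ M.closure (A₀ ∪ ((S.erase s : Finset α) : Set α)) := by
      intro z hz
      by_cases hzS : z ∈ S
      · refine M.subset_closure _ hE' (Or.inr ?_)
        rw [Finset.mem_coe, Finset.mem_erase]
        exact ⟨hz.2, hzS⟩
      · have hzcl : z ∈ M.closure A₀ := hspan ⟨hz.1, hzS⟩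
        exact M.closure_subset_closure Set.subset_union_left hzcl
    have h3 : M.closure (M.E \ {s}) ⊆ M.closure (A₀ ∪ ((S.erase s : Finset α) : Set α)) := by
      rw [← M.closure_closure (A₀ ∪ ((S.erase s : Finset α) : Set α))]
      exact M.closure_subset_closure h2
    exact h3 h1
  have hS : (S : Set α) = insert s ((S.erase s : Finset α) : Set α) := by
    rw [← Finset.coe_insert, Finset.insert_erase hs]
  have hpos : 0 < S.card := Finset.card_pos.2 ⟨s, hs⟩
  calc rk M (A₀ ∪ (S : Set α)) + 1
      = rk M (insert s (A₀ ∪ ((S.erase s : Finset α) : Set α))) + 1 := by rw [hS, Set.union_insert]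
    _ = rk M (A₀ ∪ ((S.erase s : Finset α) : Set α)) + 1 := by rw [rk_insert_of_mem_closure_set M hcl]
    _ = rk M A₀ + (S.erase s).card + 1 := by
        rw [rk_union_eq_of_series M hSE hser hA₀ hs (subset_refl _)]
    _ = rk M A₀ + S.card := by
        rw [Finset.card_erase_of_mem hs]
        omega

/-- **The rank of the complement of a series class**: `ρ(E ∖ S) + |S| = ρ(E) + 1` (`S` nonempty, pairwise in series,
no coloops). -/
lemma rk_ground_sdiff_add_card_of_series {S : Finset α} (hSE : (S : Set α) ⊆ M.E)
    (hser : ∀ x ∈ S, ∀ y ∈ S, x ≠ y → M.IsCocircuit {x, y}) (hnc : ∀ x ∈ S, ¬ M.IsColoop x)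
    (hne : S.Nonempty) {p : ℕ} (hr : M.eRank = (p : ℕ∞)) :
    rk M (M.E \ (S : Set α)) + S.card = p + 1 := by
  obtain ⟨s, hs⟩ := hne
  have h := rk_union_self_eq_of_series M hSE hser hnc (A₀ := M.E \ (S : Set α)) Set.Subset.rfl
    (M.subset_closure _ Set.sdiff_subset) hs
  rw [Set.sdiff_union_of_subset hSE] at h
  have hE : rk M M.E = p := by
    rw [rk_eq_iff M Set.Subset.rfl, eRk_ground, hr]
  omega

/-! ## The tight layer with a series class of the maximal size `p − q + 2` -/

/-- With `|S| + q = p + 2`, the complement of the series class has rank `q − 1`. -/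
lemma rk_ground_sdiff_of_series_degenerate {p q : ℕ} (hr : M.eRank = (p : ℕ∞)) {S : Finset α}
    (hSE : (S : Set α) ⊆ M.E) (hser : ∀ x ∈ S, ∀ y ∈ S, x ≠ y → M.IsCocircuit {x, y})
    (hnc : ∀ x ∈ S, ¬ M.IsColoop x) (hS2 : 2 ≤ S.card) (hk : S.card + q = p + 2) :
    rk M (M.E \ (S : Set α)) + 1 = q := by
  have h := rk_ground_sdiff_add_card_of_series M hSE hser hnc (Finset.card_pos.1 (by omega)) hr
  omega

omit [M.Finite] [DecidableEq α] in
/-- The `S`-free part of a subset of `E` avoids `S` and lies in `E`. -/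
lemma sdiff_coe_subset_ground_sdiff {S : Finset α} {A : Set α} (hA : A ⊆ M.E) :
    A \ (S : Set α) ⊆ M.E \ (S : Set α) :=
  Set.sdiff_subset_sdiff_left hA

omit [M.Finite] in
/-- A set `A` is the union of its `S`-free part and of its `S`-part `S.filter (· ∈ A)`. -/
lemma sdiff_union_filter_eq (S : Finset α) (A : Set α) [DecidablePred (fun x => x ∈ A)] :
    (A \ (S : Set α)) ∪ ((S.filter (fun x => x ∈ A) : Finset α) : Set α) = A := by
  ext z
  simp only [Set.mem_union, Set.mem_sdiff, Finset.coe_filter, Set.mem_setOf_eq, Finset.mem_coe]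
  constructor
  · rintro (⟨hz, -⟩ | ⟨-, hz⟩)
    · exact hz
    · exact hz
  · intro hz
    by_cases hzS : z ∈ S
    · exact Or.inr ⟨hzS, hz⟩
    · exact Or.inl ⟨hz, hzS⟩

open scoped Classical in
/-- **The bottom sets of a series-degenerate cell**: `|S| + q = p + 2`, `S` pairwise in series, no coloops — every
bottom set `B` meets `S` in exactly one element, its `S`-free part `B ∖ S` has rank `q − 1`, and so does the
`S`-free part of its complement. -/
lemma mem_Uq_series_degenerate {p q : ℕ} (hn : (gr M).card = p + q) (hr : M.eRank = (p : ℕ∞)) {S : Finset α}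
    (hSE : (S : Set α) ⊆ M.E) (hser : ∀ x ∈ S, ∀ y ∈ S, x ≠ y → M.IsCocircuit {x, y})
    (hnc : ∀ x ∈ S, ¬ M.IsColoop x) (hS2 : 2 ≤ S.card) (hk : S.card + q = p + 2) {B : Finset α}
    (hB : B ∈ PerFlat.Uq M p q) :
    (S.filter (fun x => x ∈ (B : Set α))).card = 1 ∧ rk M ((B : Set α) \ (S : Set α)) + 1 = q ∧
      rk M ((M.E \ (S : Set α)) \ (B : Set α)) + 1 = q := by
  obtain ⟨hBE, hBind, hBq, hbase⟩ := (mem_Uq_tight M hn hr).1 hB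
  have hBE' : (B : Set α) ⊆ M.E := by
    rw [← coe_gr M]
    exact Finset.coe_subset.2 hBE
  have hE0 := rk_ground_sdiff_of_series_degenerate M hr hSE hser hnc hS2 hk
  set T := S.filter (fun x => x ∈ (B : Set α)) with hT
  have hTS : T ⊆ S := Finset.filter_subset _ _
  have hTB : (T : Set α) ⊆ (B : Set α) := by
    intro z hz
    rw [Finset.mem_coe, hT, Finset.mem_filter] at hz
    exact hz.2
  have hBdec : (B : Set α) \ (S : Set α) ∪ (T : Set α) = (B : Set α) := by
    rw [hT]
    exact sdiff_union_filter_eq S (B : Set α)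
  have hB₀E := sdiff_coe_subset_ground_sdiff M (S := S) hBE'
  have hrkB : rk M (B : Set α) = q := by
    rw [rk_eq_iff M hBE', hBind.eRk_eq_encard, Set.encard_coe_eq_coe_finsetCard, hBq]
  have hrkB₀ : rk M ((B : Set α) \ (S : Set α)) + 1 ≤ q := by
    have := rk_mono_of_subset M hB₀E Set.sdiff_subset
    omega
  -- the complement of `B`, decomposed
  have hDE : ((gr M \ B : Finset α) : Set α) = M.E \ (B : Set α) := by
    rw [Finset.coe_sdiff, coe_gr]
  have hDdec : M.E \ (B : Set α) = ((M.E \ (S : Set α)) \ (B : Set α)) ∪ ((S \ T : Finset α) : Set α) := by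
    ext z
    simp only [Set.mem_union, Set.mem_sdiff, Finset.coe_sdiff, Finset.mem_coe, hT, Finset.mem_filter,
      not_and]
    constructor
    · rintro ⟨hz, hzB⟩
      by_cases hzS : z ∈ S
      · exact Or.inr ⟨hzS, fun _ => hzB⟩
      · exact Or.inl ⟨⟨hz, hzS⟩, hzB⟩
    · rintro (⟨⟨hz, -⟩, hzB⟩ | ⟨hzS, hzB⟩)
      · exact ⟨hz, hzB⟩
      · exact ⟨hSE (Finset.mem_coe.2 hzS), hzB hzS⟩
  have hD₀E : (M.E \ (S : Set α)) \ (B : Set α) ⊆ M.E \ (S : Set α) := Set.sdiff_subset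
  have hrkD : rk M (M.E \ (B : Set α)) = p := by
    rw [← hDE, rk_eq_iff M (by rw [hDE]; exact Set.sdiff_subset), hbase.spanning.eRk_eq, hr]
  have hrkD₀ : rk M ((M.E \ (S : Set α)) \ (B : Set α)) + 1 ≤ q := by
    have := rk_mono_of_subset M hD₀E Set.sdiff_subset
    omega
  -- `T = S` is impossible: the complement would lie in `E ∖ S`, of rank `q − 1 < p`
  have hTne : T ≠ S := by
    intro hTS'
    have hsub : M.E \ (B : Set α) ⊆ M.E \ (S : Set α) := by
      intro z hz
      refine ⟨hz.1, fun hzS => hz.2 ?_⟩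
      have : z ∈ T := by rw [hTS']; exact Finset.mem_coe.1 hzS
      exact hTB (Finset.mem_coe.2 this)
    have := rk_mono_of_subset M hsub Set.sdiff_subset
    omega
  obtain ⟨x, hxS, hxT⟩ : ∃ x ∈ S, x ∉ T :=
    Finset.exists_of_ssubset (Finset.ssubset_iff_subset_ne.2 ⟨hTS, hTne⟩)
  have hTx : T ⊆ S.erase x := fun z hz => Finset.mem_erase.2 ⟨fun h => hxT (h ▸ hz), hTS hz⟩
  -- `ρ(B) = ρ(B ∖ S) + |T|`
  have h1 : rk M (B : Set α) = rk M ((B : Set α) \ (S : Set α)) + T.card := by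
    have h := rk_union_eq_of_series M hSE hser hB₀E hxS hTx
    rw [hBdec] at h
    exact h
  -- `T` is nonempty; pick `t ∈ T`, then `S ∖ T ⊆ S ∖ t`
  have hTpos : 1 ≤ T.card := by omega
  obtain ⟨t, ht⟩ := Finset.card_pos.1 hTpos
  have htS : t ∈ S := hTS ht
  have hSTt : S \ T ⊆ S.erase t := fun z hz => by
    rw [Finset.mem_sdiff] at hz
    exact Finset.mem_erase.2 ⟨fun h => hz.2 (h ▸ ht), hz.1⟩
  have h2 : rk M (M.E \ (B : Set α)) = rk M ((M.E \ (S : Set α)) \ (B : Set α)) + (S \ T).card := by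
    rw [hDdec, rk_union_eq_of_series M hSE hser hD₀E htS hSTt]
  have hcardST : (S \ T).card + T.card = S.card := by
    rw [Finset.card_sdiff_of_subset hTS]
    have := Finset.card_le_card hTS
    omega
  refine ⟨by omega, by omega, by omega⟩

/-- **A bottom set stays a bottom set when its `S`-element is replaced by any element of `S`**
(series-degenerate cell): `B ∈ 𝓑`, `s ∈ S` ⟹ `(B ∖ S) ∪ {s} ∈ 𝓑`. -/
lemma sdiff_union_singleton_mem_Uq_of_series {p q : ℕ} (hn : (gr M).card = p + q) (hr : M.eRank = (p : ℕ∞))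
    {S : Finset α} (hSE : (S : Set α) ⊆ M.E) (hser : ∀ x ∈ S, ∀ y ∈ S, x ≠ y → M.IsCocircuit {x, y})
    (hnc : ∀ x ∈ S, ¬ M.IsColoop x) (hS2 : 2 ≤ S.card) (hk : S.card + q = p + 2) {B : Finset α}
    (hB : B ∈ PerFlat.Uq M p q) {s : α} (hs : s ∈ S) : (B \ S) ∪ {s} ∈ PerFlat.Uq M p q := by
  obtain ⟨hBE, -, -, -⟩ := (mem_Uq_tight M hn hr).1 hB
  obtain ⟨-, hrkB₀, hrkD₀⟩ := mem_Uq_series_degenerate M hn hr hSE hser hnc hS2 hk hB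
  have hBE' : (B : Set α) ⊆ M.E := by
    rw [← coe_gr M]
    exact Finset.coe_subset.2 hBE
  have hB₀E := sdiff_coe_subset_ground_sdiff M (S := S) hBE'
  -- another element of `S`
  obtain ⟨x, hxS, hxs⟩ : ∃ x ∈ S, x ≠ s := by
    exact Finset.exists_mem_ne (by omega : 1 < S.card) s
  have hsx : ({s} : Finset α) ⊆ S.erase x := fun z hz => by
    rw [Finset.mem_singleton] at hz
    rw [hz]
    exact Finset.mem_erase.2 ⟨hxs.symm, hs⟩
  rw [PerFlat.mem_Uq]
  refine ⟨?_, ?_, ?_⟩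
  · intro z hz
    rw [Finset.mem_union, Finset.mem_sdiff, Finset.mem_singleton] at hz
    rcases hz with ⟨hz, -⟩ | rfl
    · exact hBE hz
    · rw [← Finset.mem_coe, coe_gr]
      exact hSE (Finset.mem_coe.2 hs)
  · -- the rank of `(B ∖ S) ∪ {s}` is `(q − 1) + 1`
    have hcoe : (((B \ S) ∪ {s} : Finset α) : Set α) = ((B : Set α) \ (S : Set α)) ∪ (({s} : Finset α) : Set α) := by
      rw [Finset.coe_union, Finset.coe_sdiff]
    have hsub : (((B \ S) ∪ {s} : Finset α) : Set α) ⊆ M.E := by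
      rw [hcoe]
      exact Set.union_subset (hB₀E.trans Set.sdiff_subset)
        (by rw [Finset.coe_singleton]; exact Set.singleton_subset_iff.2 (hSE (Finset.mem_coe.2 hs)))
    have hval : rk M ((B : Set α) \ (S : Set α)) + ({s} : Finset α).card = q := by
      rw [Finset.card_singleton]
      omega
    rw [eRk_eq_coe_rk M hsub, hcoe, rk_union_eq_of_series M hSE hser hB₀E hxS hsx, hval]
  · -- the complement: `(E ∖ S ∖ B) ∪ (S ∖ s)`, of rank `(q − 1) + (|S| − 1) = p`
    have hcoe : ((gr M \ ((B \ S) ∪ {s}) : Finset α) : Set α)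
        = ((M.E \ (S : Set α)) \ (B : Set α)) ∪ ((S.erase s : Finset α) : Set α) := by
      rw [Finset.coe_sdiff, coe_gr]
      ext z
      simp only [Set.mem_sdiff, Finset.coe_union, Finset.coe_sdiff, Finset.coe_singleton, Set.mem_union,
        Finset.mem_coe, Set.mem_singleton_iff, Finset.mem_erase, not_or, not_and, not_not]
      constructor
      · rintro ⟨hz, hzB, hzs⟩
        by_cases hzS : z ∈ S
        · exact Or.inr ⟨hzs, hzS⟩
        · exact Or.inl ⟨⟨hz, hzS⟩, fun hzB' => hzS (hzB hzB')⟩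
      · rintro (⟨⟨hz, hzS⟩, hzB⟩ | ⟨hzs, hzS⟩)
        · exact ⟨hz, fun hzB' => absurd hzB' hzB, fun hzs => hzS (hzs ▸ hs)⟩
        · exact ⟨hSE (Finset.mem_coe.2 hzS), fun _ => hzS, hzs⟩
    have hD₀E : (M.E \ (S : Set α)) \ (B : Set α) ⊆ M.E \ (S : Set α) := Set.sdiff_subset
    have hsub : ((gr M \ ((B \ S) ∪ {s}) : Finset α) : Set α) ⊆ M.E := by
      rw [← coe_gr M]
      exact Finset.coe_subset.2 Finset.sdiff_subset
    have hval : rk M ((M.E \ (S : Set α)) \ (B : Set α)) + (S.erase s).card = p := by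
      rw [Finset.card_erase_of_mem hs]
      omega
    rw [eRk_eq_coe_rk M hsub, hcoe, rk_union_eq_of_series M hSE hser hD₀E hs (subset_refl _), hval]


end PercRepro.RankDist
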